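import Summits.KontsevichZagierPeriods.KontsevichZagierPeriods.Theorems.LogPrimitiveNL.Negative.Rigidity
import Summits.KontsevichZagierPeriods.KontsevichZagierPeriods.Theorems.LiouvilleUnfoldingLogPrimitiveNLGlue
import Summits.KontsevichZagierPeriods.KontsevichZagierPeriods.Theorems.LiouvilleUnfoldingLogPrimitiveNLStubMinNormalisation
import Summits.KontsevichZagierPeriods.KontsevichZagierPeriods.Theorems.LiouvilleUnfoldingLogPrimitiveNLStubTransfer
import Summits.KontsevichZagierPeriods.KontsevichZagierPeriods.Theorems.LiouvilleUnfoldingLogPrimitiveNLStubConeDecomposition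
import Summits.KontsevichZagierPeriods.KontsevichZagierPeriods.Theorems.LiouvilleUnfoldingLogPrimitiveNLStubCellwiseFold
import Summits.KontsevichZagierPeriods.KontsevichZagierPeriods.Theorems.LiouvilleUnfoldingLogPrimitiveNLStubPeelingStep
import Summits.KontsevichZagierPeriods.KontsevichZagierPeriods.Theorems.LiouvilleUnfoldingLogPrimitiveNLStubConstRigidity
import Summits.KontsevichZagierPeriods.KontsevichZagierPeriods.Theorems.LiouvilleUnfoldingLogPrimitiveNLStubDescent

/-!
# `LogPrimitiveNL` (stmt-KontsevichZagierPeriods-2836) — the logarithmic Newton–Leibniz step is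
derivable in the Kontsevich–Zagier calculus (route `LiouvilleUnfolding`, line `logderiv-peeling`)

Assembly of the line: the seven stubs (landed in
`Theorems/LiouvilleUnfoldingLogPrimitiveNLStub*.lean`) compose to the crux
`Summit.KontsevichZagierPeriods.KontsevichZagierPeriods.Theses.LiouvilleUnfolding.LogPrimitiveNL`:

* structure: `stub_descent stub_peelingStep stub_constRigidity` — on almost all of the base, cellwise,
  the `ℚ`-semialgebraic log-linear identity `Σ hᵢ log Wᵢ = g` forces `g ≡ 0` and `h ∈ span Λ₁(cell)`
  (Kolchin–Ostrowski along the base + Baker at rational points);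
* fold: `stub_cellwiseFold stub_coneDecomposition` — the unfolded monomials then sum to a relation
  with absolutely integrable intermediates (simplicial cone charts, product rule, integer division);
* hence `Negative.BoundaryRigidity` (`boundaryRigidity_of_stubs`, with `[g] ∈ relations` from
  `of_mem_relations_of_eqOn_zero_off_null`);
* transfer: `stub_transfer stub_minNormalisation` — min-normalisation `Ṽᵢ = Vᵢ / min_fibre Vᵢ ≥ 1`
  and the tree engine `KZ.unfoldedLogStokes_mem_relations` reduce the crux to boundary rigidity with
  `2k` monomials.
-/

noncomputable section

open Set MeasureTheory
open Literature.NumberTheory.Transcendental Literature.ModelTheory.ExponentialFields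

namespace Summit.KontsevichZagierPeriods.LiouvilleUnfolding.LogPrimitiveNL

open Summit.KontsevichZagierPeriods.KontsevichZagierPeriods.Theses.LiouvilleUnfolding (LogPrimitiveNL)

/-- **Descent + fold ⇒ boundary rigidity.** The descent (applied to `g.integrand = Σ hᵢ log Wᵢ` on
`g.domain`) gives cells on which `g.integrand = 0` — so `[g]` is a relation
(`of_mem_relations_of_eqOn_zero_off_null`) — and the lattice structure that the cellwise fold turns
into `Σ [Uᵢ] ∈ relations`. [folklore] -/
theorem boundaryRigidity_of_stubs : Negative.BoundaryRigidity := by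
  intro n k g h W U hh hW hW1 hUd hUi hUint hg
  have hσ : IsSemialgebraic ℚ g.domain := g.isSemialgebraic_domain
  have hWpos : ∀ i, ∀ x ∈ g.domain, 0 < W i x := fun i x hx => one_pos.trans_le (hW1 i x hx)
  obtain ⟨N, C, hC, hdisj, hnull, hcell⟩ :=
    stub_descent stub_peelingStep stub_constRigidity n k g.domain h W g.integrand hσ hh hW hWpos
      g.isSemialgebraicFunOn_integrand (fun x hx => (hg x hx).symm)
  have hfold : ∑ i, KZ.of (U i) ∈ KZ.relations :=
    stub_cellwiseFold stub_coneDecomposition n k g.domain h W U N C hσ hh hW hW1 hUd hUi hUint hC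
      hdisj hnull (fun c => (hcell c).2)
  have hA : IsSemialgebraic ℚ (⋃ c, C c) := by
    have : (⋃ c, C c) = ⋃ c ∈ (Finset.univ : Finset (Fin N)), C c := by simp
    rw [this]
    exact IsSemialgebraic.biUnion _ _ fun c _ => (hC c).1
  have hg0 : KZ.of g ∈ KZ.relations := by
    refine of_mem_relations_of_eqOn_zero_off_null n g (⋃ c, C c) hA
      (iUnion_subset fun c => (hC c).2.2) hnull fun x hx => ?_
    obtain ⟨c, hxc⟩ := mem_iUnion.1 hx
    exact (hcell c).1 x hxc
  exact KZ.relations.sub_mem hfold hg0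

/-- **The logarithmic Newton–Leibniz step is derivable in the four-move Kontsevich–Zagier calculus**
(crux `LogPrimitiveNL` of route `LiouvilleUnfolding`, stmt-KontsevichZagierPeriods-2836): for a band
representation `r = [{x ∈ τ, a x ≤ t ≤ b x}, Σᵢ hᵢ(x) ∂ₜVᵢ/Vᵢ]` and a base representation
`r' = [τ, Σᵢ hᵢ (log Vᵢ(·,b) − log Vᵢ(·,a))]`, both honest `KZ.IntegralRep`s, with `a ≤ b`, `hᵢ`, `Vᵢ`
`ℚ`-semialgebraic, `Vᵢ > 0` continuous on closed fibres and differentiable on open fibres, termwise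
integrability, `KZ.of r − KZ.of r' ∈ KZ.relations`. Composition of the line `logderiv-peeling`:
min-normalised transfer to boundary rigidity (`stub_transfer`, `stub_minNormalisation`) and
`boundaryRigidity_of_stubs`. -/
theorem LogPrimitiveNL_of : LogPrimitiveNL :=
  fun n k r r' a b h V V' =>
    stub_transfer stub_minNormalisation boundaryRigidity_of_stubs n k r r' a b h V V'

end Summit.KontsevichZagierPeriods.LiouvilleUnfolding.LogPrimitiveNL

end
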